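import Mathlib
import HarnessLib
import Summits.NavierStokesRegularity.NavierStokesRegularity.Theorems.UnthreadedRigidityDoorUnthreadedRigidityVirialHornIsoOrderOneLaw

/-!
# Route `UnthreadedRigidityDoor`, item `UnthreadedRigidity` (W2, stmt-NavierStokesRegularity-27585) — LINE g11-1 «VIRIAL HORN»:
# THE EULER STEP and the SLICE WEDGE LAW modulo bracket injectivity (bridge W `WindowWedgeAnalyticL`, L-part)

* `wronskian_eq_zero_of_vortAmpL` — THE EULER STEP: for two virial-admissible profiles `c₁, c₂` (smooth-even: `cᵢ(r) = hᵢ(r²)`), if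
  `K_l[c₁] c₂ − K_l[c₂] c₁ ≡ 0` on `(0,∞)` then the radial Wronskian `W = c₁ c₂′ − c₂ c₁′` vanishes on `(0,∞)`
  (`K₁c₂ − K₂c₁ = −r^{−2l−2}(r^{2l+2}W)′`, so `r^{2l+2}W` is constant on `(0,∞)`, and it tends to `0` at `0⁺`).
* `pbr_smul_of_isSolidHarmonic` — homogeneity `{B, B′}(t y) = t^{2l−1}{B, B′}(y)` (`t > 0`) for solid harmonics of degree `l ≥ 1`.
* ★ `wedgeVanishesL_of_fluxJetOne_eq_zero` — THE SLICE WEDGE LAW modulo injectivity: if the formal first jet of an admissible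
  `l`-isotypic datum `isoShellL n c B x₀` vanishes identically and the brackets `{B_m, B_{m′}}` are INJECTIVE on antisymmetric
  coefficient arrays (hypothesis `hinj`, the card's «injectivity of `Y ∧ Z ↦ {Y,Z}` on `Λ²V_l`», kit-certified for `l ≤ 7`, conjectural
  beyond), then `WedgeVanishesL n c` ((F1) `fluxJetOne_isoShellL_eq` + the Euler step).

HONEST LABEL: explicit-field calculus and one real-variable ODE step about SPECIAL isotypic data; the injectivity is a HYPOTHESIS here, and
bridge W's M-part (first jet `≡ 0` at interior times of a silent window) is not touched; `UnthreadedRigidity` (27585), W2 and NS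
regularity remain OPEN; nothing here is a statement about solutions of the Navier–Stokes equations.
`--supports stmt-NavierStokesRegularity-27585` (helper); ns-crc-p2 g8.  [cite: MajdaBertozziCUP2002, §1.1, §2.1]
-/

-- the summit and its single sub-problem share the name (CONVENTIONS §1)
set_option linter.dupNamespace false

namespace Summit.NavierStokesRegularity.NavierStokesRegularity.Theorems.UnthreadedRigidity.VirialHorn

open scoped Topology
open Filter Set Function
open Summit.NavierStokesRegularity.NavierStokesRegularity.Theorems.UnthreadedRigidity.ProfileHorn (E3)
open Literature.Analysis.FluidPDE

/-! ## §1 The Euler step -/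

/-- THE EULER STEP: for virial-admissible `c₁, c₂`, `K_l[c₁] c₂ − K_l[c₂] c₁ ≡ 0` on `(0,∞)` forces the radial Wronskian
`c₁ c₂′ − c₂ c₁′` to vanish on `(0,∞)`. [folklore] -/
theorem wronskian_eq_zero_of_vortAmpL {l : ℕ} {c₁ c₂ : ℝ → ℝ} (h₁ : VirialAdmissible l c₁) (h₂ : VirialAdmissible l c₂)
    (hK : ∀ r : ℝ, 0 < r → vortAmpL l c₁ r * c₂ r - vortAmpL l c₂ r * c₁ r = 0) (r : ℝ) (hr : 0 < r) :
    c₁ r * deriv c₂ r - c₂ r * deriv c₁ r = 0 := by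
  obtain ⟨g₁, hg₁, hc₁⟩ := h₁.1
  obtain ⟨g₂, hg₂, hc₂⟩ := h₂.1
  have hg₁' : ContDiff ℝ (⊤ : ℕ∞) (deriv g₁) := contDiff_deriv_of_contDiff_top hg₁
  have hg₂' : ContDiff ℝ (⊤ : ℕ∞) (deriv g₂) := contDiff_deriv_of_contDiff_top hg₂
  -- the explicit smooth extension `G` of the Wronskian and `F = r^{2l+2} G`
  obtain ⟨G, hG⟩ : ∃ G : ℝ → ℝ, G = fun s : ℝ =>
      g₁ (s ^ 2) * (2 * s * deriv g₂ (s ^ 2)) - g₂ (s ^ 2) * (2 * s * deriv g₁ (s ^ 2)) := ⟨_, rfl⟩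
  have hGs : ContDiff ℝ (⊤ : ℕ∞) G := by
    rw [hG]
    have hsq : ContDiff ℝ (⊤ : ℕ∞) (fun s : ℝ => s ^ 2) := contDiff_id.pow 2
    exact ((hg₁.comp hsq).mul ((contDiff_const.mul contDiff_id).mul (hg₂'.comp hsq))).sub
      ((hg₂.comp hsq).mul ((contDiff_const.mul contDiff_id).mul (hg₁'.comp hsq)))
  have hGd : Differentiable ℝ G := hGs.differentiable (by simp)
  -- the Wronskian agrees with `G` near every `s > 0`
  obtain ⟨W, hW⟩ : ∃ W : ℝ → ℝ, W = fun s : ℝ => c₁ s * deriv c₂ s - c₂ s * deriv c₁ s := ⟨_, rfl⟩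
  have hWG : ∀ s : ℝ, 0 < s → W =ᶠ[𝓝 s] G := by
    intro s hs
    filter_upwards [Ioi_mem_nhds hs] with s' hs'
    rw [hW, hG]
    simp only
    rw [deriv_profile_of_sq hg₁ hc₁ hs', deriv_profile_of_sq hg₂ hc₂ hs', hc₁ s' hs'.le, hc₂ s' hs'.le]
  -- differentiability of the profiles and of their derivatives at `s > 0`
  have hcd : ∀ {c g : ℝ → ℝ}, ContDiff ℝ (⊤ : ℕ∞) g → (∀ r : ℝ, 0 ≤ r → c r = g (r ^ 2)) → ∀ s : ℝ, 0 < s →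
      DifferentiableAt ℝ c s ∧ DifferentiableAt ℝ (deriv c) s := by
    intro c g hg hcg s hs
    have hg' : ContDiff ℝ (⊤ : ℕ∞) (deriv g) := contDiff_deriv_of_contDiff_top hg
    have e0 : c =ᶠ[𝓝 s] fun s' : ℝ => g (s' ^ 2) := by
      filter_upwards [Ioi_mem_nhds hs] with s' hs' using hcg s' hs'.le
    have e1 : deriv c =ᶠ[𝓝 s] fun s' : ℝ => 2 * s' * deriv g (s' ^ 2) := by
      filter_upwards [Ioi_mem_nhds hs] with s' hs' using deriv_profile_of_sq hg hcg hs'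
    refine ⟨e0.differentiableAt_iff.mpr ?_, e1.differentiableAt_iff.mpr ?_⟩
    · exact ((hg.differentiable (by simp)).comp (differentiable_id.pow 2)).differentiableAt
    · exact (((differentiable_const _).mul differentiable_id).mul
        ((hg'.differentiable (by simp)).comp (differentiable_id.pow 2))).differentiableAt
  -- `(2l+2) G(s) + s G′(s) = 0` for `s > 0`
  have hode : ∀ s : ℝ, 0 < s → (2 * (l : ℝ) + 2) * G s + s * deriv G s = 0 := by
    intro s hs
    obtain ⟨d₁, d₁'⟩ := hcd hg₁ hc₁ s hs
    obtain ⟨d₂, d₂'⟩ := hcd hg₂ hc₂ s hs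
    have h := vortAmpL_mul_sub_eq_wronskian l d₁ d₂ d₁' d₂'
    rw [hK s hs, ← hW] at h
    have hWs : W s = G s := (hWG s hs).self_of_nhds
    rw [(hWG s hs).deriv_eq, show c₁ s * deriv c₂ s - c₂ s * deriv c₁ s = W s by rw [hW], hWs] at h
    have hs0 : s ≠ 0 := hs.ne'
    field_simp at h
    linarith [h]
  -- `F = s^{2l+2} G` has zero derivative on `(0,∞)`, hence is constant there, and `F → 0` at `0⁺`
  obtain ⟨F, hF⟩ : ∃ F : ℝ → ℝ, F = fun s : ℝ => s ^ (2 * l + 2) * G s := ⟨_, rfl⟩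
  have hFd : Differentiable ℝ F := by
    rw [hF]
    exact (differentiable_id.pow _).mul hGd
  have hF' : (Ioi (0 : ℝ)).EqOn (deriv F) 0 := by
    intro s hs
    have hs' : 0 < s := hs
    have hpow : HasDerivAt (fun s : ℝ => s ^ (2 * l + 2)) (((2 * l + 2 : ℕ) : ℝ) * s ^ (2 * l + 1)) s := by
      simpa using hasDerivAt_pow (2 * l + 2) s
    have hprod : HasDerivAt F (((2 * l + 2 : ℕ) : ℝ) * s ^ (2 * l + 1) * G s + s ^ (2 * l + 2) * deriv G s) s := by
      rw [hF]
      exact hpow.mul (hGd s).hasDerivAt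
    rw [Pi.zero_apply, hprod.deriv]
    have e : s ^ (2 * l + 2) = s ^ (2 * l + 1) * s := pow_succ s (2 * l + 1)
    rw [e]
    push_cast
    linear_combination (s ^ (2 * l + 1)) * hode s hs'
  have hconst : F r = F (r / 2) :=
    isOpen_Ioi.is_const_of_deriv_eq_zero isPreconnected_Ioi hFd.differentiableOn hF' hr (half_pos hr)
  -- `F` is constant `= F r` on `(0, ∞)` and continuous at `0` with `F 0 = 0`
  have hFc : ∀ s : ℝ, 0 < s → F s = F r := fun s hs =>
    isOpen_Ioi.is_const_of_deriv_eq_zero isPreconnected_Ioi hFd.differentiableOn hF' hs hr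
  have hF0 : F 0 = 0 := by
    rw [hF]
    simp
  have hlim : Tendsto F (𝓝[>] (0 : ℝ)) (𝓝 (F r)) := by
    apply tendsto_const_nhds.congr'
    filter_upwards [self_mem_nhdsWithin] with s hs using (hFc s hs).symm
  have hlim0 : Tendsto F (𝓝[>] (0 : ℝ)) (𝓝 (F 0)) :=
    (hFd.continuous.tendsto 0).mono_left nhdsWithin_le_nhds
  have hFr : F r = 0 := by
    have := tendsto_nhds_unique hlim hlim0
    rw [this, hF0]
  -- conclude
  have hWr : W r = G r := (hWG r hr).self_of_nhds
  have hGr : G r = 0 := by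
    have e : F r = r ^ (2 * l + 2) * G r := by rw [hF]
    rw [e] at hFr
    exact (mul_eq_zero.mp hFr).resolve_left (pow_ne_zero _ hr.ne')
  have : W r = 0 := hWr.trans hGr
  rw [hW] at this
  exact this

/-! ## §2 Homogeneity of the bracket -/

/-- HOMOGENEITY OF THE BRACKET: `{B, B′}(t y) = t^{2l−1} {B, B′}(y)` for solid harmonics of degree `l ≥ 1` and `t > 0`. [folklore] -/
theorem pbr_smul_of_isSolidHarmonic {l : ℕ} (hl : 1 ≤ l) {B B' : E3 → ℝ} (hB : IsSolidHarmonic l B)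
    (hB' : IsSolidHarmonic l B') {t : ℝ} (ht : 0 < t) (y : E3) :
    pbr B B' (t • y) = t ^ (2 * l - 1) * pbr B B' y := by
  have e1 : gradient B (t • y) = t ^ (l - 1) • gradient B y := by
    rw [hB.gradient_smul t ht y, ← zpow_natCast, Nat.cast_sub hl]
    norm_cast
  have e2 : gradient B' (t • y) = t ^ (l - 1) • gradient B' y := by
    rw [hB'.gradient_smul t ht y, ← zpow_natCast, Nat.cast_sub hl]
    norm_cast
  rw [pbr, pbr, e1, e2]
  simp only [det3, PiLp.smul_apply, smul_eq_mul]
  have e3 : t ^ (2 * l - 1) = t * (t ^ (l - 1) * t ^ (l - 1)) := by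
    rw [← pow_add, ← pow_succ']
    congr 1
    omega
  rw [e3]
  ring

/-! ## §3 ★ The slice wedge law modulo bracket injectivity -/

/-- ★ THE SLICE WEDGE LAW modulo injectivity: for an admissible `l`-isotypic family (`l ≥ 1`), if the formal first threading jet of
`isoShellL n c B x₀` about `x₀` vanishes identically, and the brackets `{B_m, B_{m′}}` are injective on coefficient arrays in the sense
`(∀ y, Σ_{m,m′} w_{mm′} {B_m,B_{m′}}(y) = 0) → w` symmetric (the card's injectivity of `Y ∧ Z ↦ {Y,Z}` for the family `B`), then all radial
Wronskians vanish on `(0,∞)`: `WedgeVanishesL n c`.  ((F1) `fluxJetOne_isoShellL_eq`, homogeneity, and the Euler step.) -/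
theorem wedgeVanishesL_of_fluxJetOne_eq_zero {l n : ℕ} (hl : 1 ≤ l) {c : Fin n → ℝ → ℝ} {B : Fin n → E3 → ℝ}
    (hadm : IsoAdmissibleL l n c B) (x₀ : E3)
    (hinj : ∀ w : Fin n → Fin n → ℝ, (∀ y : E3, ∑ m, ∑ m', w m m' * pbr (B m) (B m') y = 0) → ∀ m m', w m m' = w m' m)
    (h0 : ∀ x : E3, ThreadingJets.fluxJetOne (isoShellL n c B x₀) x₀ x = 0) :
    WedgeVanishesL n c := by
  have hL : ((l : ℝ) * ((l : ℝ) + 1)) ≠ 0 := by positivity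
  -- at each radius `r > 0` the coefficient array `K_m(r) c_{m′}(r)` is symmetric
  have hsym : ∀ r : ℝ, 0 < r → ∀ m m',
      vortAmpL l (c m) r * c m' r = vortAmpL l (c m') r * c m r := by
    intro r hr
    refine hinj (fun m m' => vortAmpL l (c m) r * c m' r) fun y => ?_
    rcases eq_or_ne y 0 with hy | hy
    · subst hy
      simp only [pbr_apply_zero, mul_zero, Finset.sum_const_zero]
    · -- scale `y` to the sphere of radius `r`
      have hyn : 0 < ‖y‖ := norm_pos_iff.mpr hy
      set t : ℝ := r / ‖y‖ with ht
      have htp : 0 < t := div_pos hr hyn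
      have hty : ‖t • y‖ = r := by
        rw [norm_smul, Real.norm_of_nonneg htp.le, ht, div_mul_cancel₀ r hyn.ne']
      have hjet := h0 (x₀ + t • y)
      rw [fluxJetOne_isoShellL_eq hl hadm x₀ (t • y), hty, mul_eq_zero] at hjet
      have hsum := hjet.resolve_left hL
      have hscale : ∑ m, ∑ m', vortAmpL l (c m) r * c m' r * pbr (B m) (B m') (t • y) =
          t ^ (2 * l - 1) * ∑ m, ∑ m', vortAmpL l (c m) r * c m' r * pbr (B m) (B m') y := by
        rw [Finset.mul_sum]
        refine Finset.sum_congr rfl fun m _ => ?_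
        rw [Finset.mul_sum]
        refine Finset.sum_congr rfl fun m' _ => ?_
        rw [pbr_smul_of_isSolidHarmonic hl (hadm.1 m) (hadm.1 m') htp y]
        ring
      rw [hscale, mul_eq_zero] at hsum
      exact hsum.resolve_left (pow_ne_zero _ htp.ne')
  intro m m' r hr
  exact wronskian_eq_zero_of_vortAmpL (hadm.2 m) (hadm.2 m') (fun s hs => by rw [hsym s hs m m']; ring) r hr

end Summit.NavierStokesRegularity.NavierStokesRegularity.Theorems.UnthreadedRigidity.VirialHorn
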